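import Mathlib.NumberTheory.Chebyshev
import Mathlib.Analysis.Complex.ExponentialBounds
import Literature.NumberTheory.LFunctions.SchoenfeldPsiSmall
import HarnessLib

/-!
# Stub `stub_helsonG` of crux `WeilComb.CombShapePositivity` — the exponentiated generating function
(item stmt-RiemannHypothesis-11229, route route-RiemannHypothesis-WeilComb, line `Sketch`;
siege attempt k4, generation 1; variation: generating-function manipulation)

The registered stub is the Helson-potential bound with constant `39/50`: for every `M` and
`a : ℕ → ℂ`,

`Σ_{m ≤ M} ‖a_m‖² (log m + U(⌊M/m⌋)) ≤ (log M + 39/50) Σ_{m ≤ M} ‖a_m‖²`, `U(N) = Σ_{n ≤ N} Λ(n)/n`.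

Termwise this is `U(N) ≤ log N + 39/50` for `N ≥ 1` together with `log m + log ⌊M/m⌋ ≤ log M`.

## Proof: one Dirichlet-series identity, exponentiated, and an integer certificate

The Dirichlet generating function of `Λ` is `−ζ'/ζ`, and `(−ζ'/ζ) · ζ = −ζ'` is the identity
`Λ * ζ = log` of arithmetic functions (Mathlib's `ArithmeticFunction.vonMangoldt_mul_zeta`).
Summed over `n ≤ N` (`ArithmeticFunction.sum_Ioc_mul_zeta_eq_sum`) it is Chebyshev's

`Σ_{k ≤ N} Λ(k) ⌊N/k⌋ = Σ_{n ≤ N} log n = log N!`,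

i.e. Legendre's `N! = ∏_{p^a ≤ N} p^{⌊N/p^a⌋}` after exponentiation; in the same way
`e^{ψ(N)} = lcm(1, …, N)` (Mathlib's `Chebyshev.psi_eq_log_lcmUpto`). Since `(N+1)/k ≤ ⌊N/k⌋ + 1`,

`(N + 1) · U(N) ≤ Σ_{k ≤ N} Λ(k) (⌊N/k⌋ + 1) = log (N! · lcm(1, …, N))`,

so the whole stub is the INTEGER inequality `N! · lcm(1, …, N) ≤ (e^{39/50} N)^{N+1}`, which we
establish in two regimes.

* `1 ≤ N ≤ 2048`: the stronger `N! · lcm(1, …, N) ≤ (2N)^{N+1}` (`log 2 < 39/50`) is certified by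
  the kernel — `decide +kernel` on a running-factorial / running-lcm recursion (2048 steps of exact
  integer arithmetic, written with `Nat.rec` so that no auxiliary definition is introduced).
* `N ≥ 2048`: `log N! ≤ (N+1) log N − N + 1` (from `log(1 + 1/N) ≥ 1/(N+1)`) and Mathlib's
  Chebyshev bound `ψ(N) ≤ N log 4 + 2 √N log N` (`Chebyshev.psi_le`, itself the primorial /
  central-binomial generating-function argument), with the budget
  `2 √N log N + 0.22 ≤ (1.78 − log 4) N` for `√N ≥ 45` (`log √N ≤ 5 log 2 − 1 + √N/32`).

Hence `U(N) ≤ log N + 39/50` for every `N ≥ 1` (the truth is `log N − γ + o(1)`, and `≤ log N`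
throughout), the row bound, and the stub. Dependencies: Mathlib, plus the one-line recursion
`lcm(1,…,n+1) = lcm(n+1, lcm(1,…,n))` (`SchoenfeldBound.lcmUpto_succ`) from the tree; no `ψ`-table is
used (the tree's `ψ ≤ 1.04 x` on `[0, 10⁴]` would also do below `2048` — the point here is that the
certificate checks exactly the integer inequality the stub needs); the only numerical constant is
`Real.log_two_lt_d9`.

References: P. L. Chebyshev, *Mémoire sur les nombres premiers*, J. Math. Pures Appl. 17 (1852)
(the identity and the `ψ` bound); A.-M. Legendre, *Essai sur la théorie des nombres* (2nd ed.,
1808) (`N! = ∏ p^{Σ_a ⌊N/p^a⌋}`); F. Mertens, J. reine angew. Math. 78 (1874)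
(`Σ_{n ≤ x} Λ(n)/n = log x + O(1)`); exposition: Hardy–Wright, Ch. XXII.
This file does NOT touch the other stubs of the line or the skeleton; it proves `stub_helsonG`
by name and signature in its own namespace.
-/

noncomputable section

-- the sub-problem path `RiemannHypothesis/RiemannHypothesis` (single-conjunct summit, D-0017)
-- duplicates a namespace component
set_option linter.dupNamespace false

open Finset ArithmeticFunction
open scoped Nat Chebyshev

namespace Summit.RiemannHypothesis.RiemannHypothesis.Theorems.WeilCombBohrFejer.HelsonGFactorialLcm

/-! ### 1. The generating-function identity `Λ * ζ = log`, summed and exponentiated -/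

/-- `Σ_{0 < n ≤ N} log n = log N!`. [folklore] -/
theorem sum_Ioc_log_eq_log_factorial (N : ℕ) :
    ∑ n ∈ Ioc 0 N, Real.log n = Real.log (N ! : ℝ) := by
  induction N with
  | zero => simp
  | succ k ih =>
    rw [sum_Ioc_succ_top (Nat.zero_le k), ih, Nat.factorial_succ, Nat.cast_mul,
      Real.log_mul (by positivity) (by positivity), add_comm]

/-- **Chebyshev's identity** `Σ_{0 < k ≤ N} Λ(k) ⌊N/k⌋ = log N!`: the Dirichlet-series identity
`(−ζ'/ζ)·ζ = −ζ'`, i.e. `Λ * ζ = log`, summed over `n ≤ N` (exponentiated: Legendre's formula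
`N! = ∏_{p^a ≤ N} p^{⌊N/p^a⌋}`). [folklore] -/
theorem sum_Ioc_vonMangoldt_mul_div (N : ℕ) :
    ∑ k ∈ Ioc 0 N, Λ k * ((N / k : ℕ) : ℝ) = Real.log (N ! : ℝ) := by
  have h := sum_Ioc_mul_zeta_eq_sum Λ N
  rw [vonMangoldt_mul_zeta] at h
  rw [← h, ← sum_Ioc_log_eq_log_factorial]
  exact sum_congr rfl fun n _ ↦ log_apply

/-- `Σ_{0 < k ≤ N} Λ(k) = ψ(N) = log lcm(1, …, N)` (`e^{ψ(N)} = lcm(1, …, N)`). [folklore] -/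
theorem sum_Ioc_vonMangoldt_eq_log_lcmUpto (N : ℕ) :
    ∑ k ∈ Ioc 0 N, Λ k = Real.log (Nat.lcmUpto N : ℝ) := by
  rw [← Chebyshev.psi_eq_log_lcmUpto, Chebyshev.psi, Nat.floor_natCast]

/-- **The master inequality** `(N + 1) · Σ_{k ≤ N} Λ(k)/k ≤ log (N! · lcm(1, …, N))`
(from `(N+1)/k ≤ ⌊N/k⌋ + 1`, Chebyshev's identity and `ψ(N) = log lcm(1, …, N)`). [folklore] -/
theorem succ_mul_sum_vonMangoldt_div_le_log (N : ℕ) :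
    ((N : ℝ) + 1) * ∑ k ∈ Ioc 0 N, Λ k / k ≤ Real.log ((N ! * Nat.lcmUpto N : ℕ) : ℝ) := by
  have hL : (Nat.lcmUpto N : ℝ) ≠ 0 := by exact_mod_cast Nat.lcmUpto_ne_zero N
  rw [Nat.cast_mul, Real.log_mul (by positivity) hL, ← sum_Ioc_vonMangoldt_mul_div,
    ← sum_Ioc_vonMangoldt_eq_log_lcmUpto, ← sum_add_distrib, mul_sum]
  refine sum_le_sum fun k hk ↦ ?_
  have hk0 : 0 < k := (mem_Ioc.1 hk).1
  have hk0' : (0 : ℝ) < k := by exact_mod_cast hk0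
  have hdiv : N + 1 ≤ N / k * k + k := Nat.lt_div_mul_add hk0
  have hdiv' : (N : ℝ) + 1 ≤ ((N / k : ℕ) : ℝ) * k + k := by exact_mod_cast hdiv
  have hΛ : 0 ≤ Λ k := vonMangoldt_nonneg
  calc ((N : ℝ) + 1) * (Λ k / k) = Λ k * (((N : ℝ) + 1) / k) := by ring
    _ ≤ Λ k * (((N / k : ℕ) : ℝ) + 1) := by
        refine mul_le_mul_of_nonneg_left ?_ hΛ
        rw [div_le_iff₀ hk0']
        linarith
    _ = Λ k * ((N / k : ℕ) : ℝ) + Λ k := by ring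

/-! ### 2. The kernel certificate `N! · lcm(1, …, N) ≤ (2N)^{N+1}` for `1 ≤ N ≤ 2048` -/

/-- Soundness of the certificate recursion. If `c : ℕ → ℕ × ℕ × Bool` starts at `(1, 1, true)`
and steps by `(F, L, b) ↦ ((k+1)·F, lcm(k+1, L), b ∧ [(k+1)·F · lcm(k+1, L) ≤ (2(k+1))^{k+2}])`,
then `c k = (k!, lcm(1, …, k), flag)` and a `true` flag at `K` certifies
`m! · lcm(1, …, m) ≤ (2m)^{m+1}` for every `1 ≤ m ≤ K`. [folklore] -/
theorem cert_sound {c : ℕ → ℕ × ℕ × Bool} (h0 : c 0 = (1, 1, true))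
    (hs : ∀ k, c (k + 1) = ((k + 1) * (c k).1, Nat.lcm (k + 1) (c k).2.1,
      ((c k).2.2 && Nat.ble ((k + 1) * (c k).1 * Nat.lcm (k + 1) (c k).2.1)
        ((2 * (k + 1)) ^ (k + 1 + 1)))))
    (K : ℕ) (hK : (c K).2.2 = true) :
    ∀ m, 1 ≤ m → m ≤ K → m ! * Nat.lcmUpto m ≤ (2 * m) ^ (m + 1) := by
  -- the invariant of the recursion
  have inv : ∀ k, (c k).1 = k ! ∧ (c k).2.1 = Nat.lcmUpto k ∧
      ((c k).2.2 = true → ∀ m, 1 ≤ m → m ≤ k → m ! * Nat.lcmUpto m ≤ (2 * m) ^ (m + 1)) := by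
    intro k
    induction k with
    | zero =>
      rw [h0]
      exact ⟨rfl, by simp [Nat.lcmUpto], fun _ m h1 h2 ↦ by omega⟩
    | succ k ih =>
      obtain ⟨hF, hL, hB⟩ := ih
      have hF' : (k + 1) * (c k).1 = (k + 1)! := by rw [hF, Nat.factorial_succ]
      have hL' : Nat.lcm (k + 1) (c k).2.1 = Nat.lcmUpto (k + 1) := by
        rw [hL, Literature.NumberTheory.LFunctions.SchoenfeldBound.lcmUpto_succ]
      rw [hs k]
      refine ⟨hF', hL', fun h m h1 h2 ↦ ?_⟩
      simp only [Bool.and_eq_true, Nat.ble_eq] at h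
      obtain ⟨hb, hineq⟩ := h
      rcases Nat.lt_or_ge m (k + 1) with hlt | hge
      · exact hB hb m h1 (by omega)
      · obtain rfl : m = k + 1 := le_antisymm h2 hge
        rwa [hF', hL'] at hineq
  exact (inv K).2.2 hK

/-- **The kernel certificate**: `N! · lcm(1, …, N) ≤ (2N)^{N+1}` for `1 ≤ N ≤ 2048`. The
recursion of `cert_sound` is instantiated DEFINITION-FREE by `Nat.rec` on the state
`(running factorial, running lcm, flag)` and its flag after 2048 steps of exact integer arithmetic
is evaluated to `true` by the kernel (`decide +kernel`, ≈ 3 s). (The inequality is in fact true for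
all `N ≥ 1`, with logarithmic slack `≈ 0.65 N`.) [folklore] -/
theorem factorial_mul_lcmUpto_le {N : ℕ} (h1 : 1 ≤ N) (h2 : N ≤ 2048) :
    N ! * Nat.lcmUpto N ≤ (2 * N) ^ (N + 1) :=
  cert_sound
    (c := fun n ↦ Nat.rec (motive := fun _ ↦ ℕ × ℕ × Bool) ((1, 1, true) : ℕ × ℕ × Bool)
      (fun k s ↦ ((k + 1) * s.1, Nat.lcm (k + 1) s.2.1,
        (s.2.2 && Nat.ble ((k + 1) * s.1 * Nat.lcm (k + 1) s.2.1) ((2 * (k + 1)) ^ (k + 1 + 1)))))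
      n)
    rfl (fun _ ↦ rfl) 2048 (by decide +kernel) N h1 h2

/-- Small regime: `log (N! · lcm(1, …, N)) ≤ (N+1)(log N + 39/50)` for `1 ≤ N ≤ 2048`
(the certificate and `log 2 < 39/50`). [folklore] -/
theorem log_factorial_mul_lcmUpto_le_of_le {N : ℕ} (h1 : 1 ≤ N) (h2 : N ≤ 2048) :
    Real.log ((N ! * Nat.lcmUpto N : ℕ) : ℝ) ≤ ((N : ℝ) + 1) * (Real.log N + 39 / 50) := by
  have h : ((N ! * Nat.lcmUpto N : ℕ) : ℝ) ≤ (2 * (N : ℝ)) ^ (N + 1) := by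
    exact_mod_cast factorial_mul_lcmUpto_le h1 h2
  have hpos : (0 : ℝ) < ((N ! * Nat.lcmUpto N : ℕ) : ℝ) := by
    exact_mod_cast Nat.mul_pos (Nat.factorial_pos N) (Nat.lcmUpto_pos N)
  have hN : (0 : ℝ) < N := by exact_mod_cast h1
  have hlog := Real.log_le_log hpos h
  rw [Real.log_pow, Nat.cast_add, Nat.cast_one, Real.log_mul (by norm_num) hN.ne'] at hlog
  have hl2 := Real.log_two_lt_d9
  have hstep : ((N : ℝ) + 1) * (Real.log 2 + Real.log N) ≤
      ((N : ℝ) + 1) * (Real.log N + 39 / 50) :=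
    mul_le_mul_of_nonneg_left (by linarith) (by positivity)
  linarith

/-! ### 3. The analytic regime `N ≥ 2048` -/

/-- `log N! ≤ (N + 1) log N − N + 1` for `N ≥ 1` (induction; the step is
`1 ≤ (N+1) log(1 + 1/N)`, i.e. `log x ≤ x − 1` at `x = N/(N+1)`). [folklore] -/
theorem log_factorial_le {N : ℕ} (hN : 1 ≤ N) :
    Real.log (N ! : ℝ) ≤ ((N : ℝ) + 1) * Real.log N - N + 1 := by
  induction N, hN using Nat.le_induction with
  | base => simp
  | succ k hk ih =>
    have hk0 : (0 : ℝ) < k := by exact_mod_cast hk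
    have hk1 : (0 : ℝ) < k + 1 := by positivity
    rw [Nat.factorial_succ, Nat.cast_mul, Real.log_mul (by positivity) (by positivity)]
    push_cast
    -- the step inequality `(k+1)(log k − log (k+1)) ≤ −1`
    have hx : Real.log ((k : ℝ) / (k + 1)) ≤ (k : ℝ) / (k + 1) - 1 :=
      Real.log_le_sub_one_of_pos (by positivity)
    rw [Real.log_div hk0.ne' hk1.ne'] at hx
    have hx' : (Real.log (k : ℝ) - Real.log ((k : ℝ) + 1) + 1) * ((k : ℝ) + 1) ≤ k := by
      rw [← le_div_iff₀ hk1]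
      linarith
    nlinarith [hx', ih]

/-- The Chebyshev budget beyond the certificate: for `N ≥ 2048`,
`N log 4 + 2 √N log N ≤ 1.78 N − 0.22` (`log √N ≤ 5 log 2 − 1 + √N/32`, `√N ≥ 45`,
`log 2 < 0.6931471808`). [folklore] -/
theorem chebyshev_budget {N : ℕ} (hN : 2048 ≤ N) :
    Real.log 4 * N + 2 * Real.sqrt N * Real.log N ≤ 1.78 * N - 0.22 := by
  set s := Real.sqrt (N : ℝ) with hs
  have hN' : (2048 : ℝ) ≤ N := by exact_mod_cast hN
  have hs0 : 0 ≤ s := Real.sqrt_nonneg _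
  have hsq : s ^ 2 = N := Real.sq_sqrt (by positivity)
  have hs45 : 45 ≤ s := by
    rw [hs, show (45 : ℝ) = Real.sqrt (45 ^ 2) by rw [Real.sqrt_sq (by norm_num)]]
    exact Real.sqrt_le_sqrt (by nlinarith)
  have hlogN : Real.log N = 2 * Real.log s := by
    rw [← hsq, Real.log_pow]
    norm_num
  have hlogs : Real.log s ≤ 5 * Real.log 2 - 1 + s / 32 := by
    have h1 := Real.log_le_sub_one_of_pos (show (0 : ℝ) < s / 32 by positivity)
    rw [Real.log_div (by positivity) (by norm_num)] at h1
    have h32 : Real.log (32 : ℝ) = 5 * Real.log 2 := by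
      rw [show (32 : ℝ) = 2 ^ 5 by norm_num, Real.log_pow]
      norm_num
    linarith
  have hl2 := Real.log_two_lt_d9
  have hlog4 : Real.log 4 = 2 * Real.log 2 := by
    rw [show (4 : ℝ) = 2 ^ 2 by norm_num, Real.log_pow]
    norm_num
  rw [hlog4, hlogN, ← hsq]
  -- goal: `2 log 2 · s² + 2 s (2 log s) ≤ 1.78 s² − 0.22`
  have hA : s * Real.log s ≤ s * (5 * Real.log 2 - 1 + s / 32) :=
    mul_le_mul_of_nonneg_left hlogs hs0
  have hB : Real.log 2 * s ≤ 0.6931471808 * s := mul_le_mul_of_nonneg_right hl2.le hs0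
  have hC : Real.log 2 * s ^ 2 ≤ 0.6931471808 * s ^ 2 :=
    mul_le_mul_of_nonneg_right hl2.le (by positivity)
  have hD : 45 * s ≤ s ^ 2 := by nlinarith
  nlinarith [hA, hB, hC, hD, hs45]

/-- Large regime: `log (N! · lcm(1, …, N)) = log N! + ψ(N) ≤ (N+1)(log N + 39/50)` for
`N ≥ 2048`. [folklore] -/
theorem log_factorial_mul_lcmUpto_le_of_ge {N : ℕ} (hN : 2048 ≤ N) :
    Real.log ((N ! * Nat.lcmUpto N : ℕ) : ℝ) ≤ ((N : ℝ) + 1) * (Real.log N + 39 / 50) := by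
  have hN1 : 1 ≤ N := le_trans (by norm_num) hN
  have hL : (Nat.lcmUpto N : ℝ) ≠ 0 := by exact_mod_cast Nat.lcmUpto_ne_zero N
  rw [Nat.cast_mul, Real.log_mul (by positivity) hL, ← Chebyshev.psi_eq_log_lcmUpto]
  have h1 := log_factorial_le hN1
  have h2 := Chebyshev.psi_le (x := (N : ℝ)) (by exact_mod_cast hN1)
  have h3 := chebyshev_budget hN
  linarith

/-- Both regimes: `log (N! · lcm(1, …, N)) ≤ (N+1)(log N + 39/50)` for every `N ≥ 1`. [folklore] -/
theorem log_factorial_mul_lcmUpto_le {N : ℕ} (hN : 1 ≤ N) :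
    Real.log ((N ! * Nat.lcmUpto N : ℕ) : ℝ) ≤ ((N : ℝ) + 1) * (Real.log N + 39 / 50) := by
  rcases le_or_gt N 2048 with h | h
  · exact log_factorial_mul_lcmUpto_le_of_le hN h
  · exact log_factorial_mul_lcmUpto_le_of_ge h.le

/-! ### 4. The Mertens-type bound, the row bound, and the stub -/

/-- **`Σ_{n ≤ N} Λ(n)/n ≤ log N + 39/50` for every natural `N ≥ 1`.** [folklore] -/
theorem sum_vonMangoldt_div_le {N : ℕ} (hN : 1 ≤ N) :
    ∑ n ∈ Icc 1 N, (ArithmeticFunction.vonMangoldt n : ℝ) / n ≤ Real.log N + 39 / 50 := by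
  have hI : Icc 1 N = Ioc 0 N := by
    ext n
    simp only [mem_Icc, mem_Ioc]
    omega
  rw [hI]
  have hpos : (0 : ℝ) < (N : ℝ) + 1 := by positivity
  exact le_of_mul_le_mul_left
    ((succ_mul_sum_vonMangoldt_div_le_log N).trans (log_factorial_mul_lcmUpto_le hN)) hpos

/-- The row bound of the Helson potential: for `1 ≤ m ≤ M`,
`log m + Σ_{n ≤ M/m} Λ(n)/n ≤ log M + 39/50` (since `m · ⌊M/m⌋ ≤ M`). [folklore] -/
theorem log_add_sum_vonMangoldt_div_le {M m : ℕ} (hm : m ∈ Icc 1 M) :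
    Real.log m + ∑ n ∈ Icc 1 (M / m), (ArithmeticFunction.vonMangoldt n : ℝ) / n ≤
      Real.log M + 39 / 50 := by
  obtain ⟨hm1, hmM⟩ := mem_Icc.1 hm
  have hq : 1 ≤ M / m := (Nat.le_div_iff_mul_le hm1).2 (by simpa using hmM)
  have hm0 : (0 : ℝ) < m := by exact_mod_cast hm1
  have hq0 : (0 : ℝ) < ((M / m : ℕ) : ℝ) := by exact_mod_cast hq
  have hprod : (m : ℝ) * ((M / m : ℕ) : ℝ) ≤ M := by exact_mod_cast Nat.mul_div_le M m
  have hlog : Real.log m + Real.log ((M / m : ℕ) : ℝ) ≤ Real.log M := by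
    rw [← Real.log_mul hm0.ne' hq0.ne']
    exact Real.log_le_log (by positivity) hprod
  linarith [sum_vonMangoldt_div_le hq]

/-- **Stub S4 (`stub_helsonG`) — the Helson potential with the constant `39/50`.** For every `M`
and `a : ℕ → ℂ`: `Σ_m ‖a_m‖² (log m + Σ_{n ≤ M/m} Λ(n)/n) ≤ (log M + 39/50) Σ_m ‖a_m‖²`
(termwise from `log_add_sum_vonMangoldt_div_le`). Registered stub of line `Sketch` of crux
stmt-RiemannHypothesis-11229, proved by the exponentiated generating function
`N! · lcm(1, …, N) ≤ (e^{39/50} N)^{N+1}`. [folklore] -/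
theorem stub_helsonG : ∀ (M : ℕ) (a : ℕ → ℂ),
    ∑ m ∈ Finset.Icc 1 M, ‖a m‖ ^ 2 *
        (Real.log m + ∑ n ∈ Finset.Icc 1 (M / m), (ArithmeticFunction.vonMangoldt n : ℝ) / n) ≤
      (Real.log M + 39 / 50) * ∑ m ∈ Finset.Icc 1 M, ‖a m‖ ^ 2 := by
  intro M a
  rw [mul_sum]
  refine sum_le_sum fun m hm ↦ ?_
  rw [mul_comm (Real.log M + 39 / 50)]
  exact mul_le_mul_of_nonneg_left (log_add_sum_vonMangoldt_div_le hm) (by positivity)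

end Summit.RiemannHypothesis.RiemannHypothesis.Theorems.WeilCombBohrFejer.HelsonGFactorialLcm

end
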